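import Mathlib
import HarnessLib
import Summits.HubbardSuperconductivity.HubbardSuperconductivity.Theorems.WeakCouplingBCSKlHigherOrderSelection
import Summits.HubbardSuperconductivity.HubbardSuperconductivity.Theorems.WeakCouplingBCSDefsKlThirdOrder
import Summits.HubbardSuperconductivity.HubbardSuperconductivity.Theorems.WeakCouplingBCSKlCertB1gWindowD010D020

/-!
# WeakCouplingBCS — KL certificate: the explicit-`U₀` slot made non-vacuous THROUGH THIRD ORDER (statements first, kit-free)

The CHANNEL-MARGIN lane's slot file `…KlHigherOrderSelection` (✓ p731561) converts a certified second-order margin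
`KLB1gDominatesTP tp a b γ` plus a remainder hypothesis `KLChannelRemainderBound tp a b Λ C U₁` on an ABSTRACT full channel
strength `Λ` into strict `B1g` selection below `klU0 γ C U₁ = min(1, U₁, γ/2C)`.  This file supplies the first CONCRETE `Λ` of the
tree for that slot — the channel bottoms of the particle–particle-irreducible vertex TRUNCATED AT THIRD ORDER (objects of
`…DefsKlThirdOrder`: `K₃ = klThirdOrderKernel`, `kform`, `channelInf3`) — and proves the remainder hypothesis for it from ONE
two-sided third-order enclosure kind, with no finiteness or Hilbert–Schmidt hypothesis and for every `t′`:

* §1 `kl_abs_sInf_image_add_sub_le` — the inf-perturbation lemma of real analysis, INCLUDING the junk cases of `Real.sInf`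
  (empty or unbounded-below image sets give `0 = 0`): `(∀ x ∈ S, |g x| ≤ M) → 0 ≤ M → |sInf ((f + g) '' S) − sInf (f '' S)| ≤ M`.
* §2 `klLambda3 tp χ μ U = inf_ψ (pairingForm ε_{t′} μ U ψ + U³ ⟨ψ, K₃ ψ⟩)` over the normalised channel states of `χ` — the
  third-order channel bottom in pairing units — and the HYPOTHESIS KIND (a slot; asserts nothing)
  `KlThirdOrder.FormBound tp a b M := ∀ μ ∈ [a, b], ∀ χ ψ, IsChannelState ε_{t′} μ χ ψ → |⟨ψ, K₃ ψ⟩_{σ_μ}| ≤ M`.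
* §3 `klChannelRemainderBound_lambda3` — `0 ≤ M → FormBound tp a b M → KLChannelRemainderBound tp a b (klLambda3 tp) M U₁` (any `U₁`).
* §4 `klLambda3_zero_eq` — identification at `t′ = 0`, `μ ∈ (−4, 0)`, `0 < U`: `klLambda3 0 χ μ U = U² · channelInf3 ε₀ μ U χ`
  (the tree's Hilbert–Schmidt frame `stub_klFrameHS` / `stub_klKernelHS` splits `pairingForm`; `Real.sInf_smul_of_nonneg`).
* §5 selection THROUGH THIRD ORDER below the explicit `U₀ = klU0 γ M 1 = min(1, γ/2M)`: generic from `KLB1gDominatesTP 0 a b γ`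
  (`klChannelInf3_B1g_lt_of_dominates`), from any accepted `t′ = 0` record (`…_of_checkB1gD`), and BY NAME on the doping window
  `δ ∈ [0.10, 0.20]` = `μ ∈ [−0.42749, −0.1775]` from the three window records `klCertB1gWin{A,B,C}` (✓ `klb1g_window_d010_d020`,
  `γ = min(γ_A, γ_B, γ_C) = 437/16384`): **`channelInf3 ε₀ μ U B1g < channelInf3 ε₀ μ U χ` for every such `μ`, every
  `0 < U < min(1, γ/2M)` and every `χ ≠ B1g`** — modulo the records' `EnclosuresB1g` and `FormBound 0 (−0.42749) (−0.1775) M`.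
* §6 the all-orders twin: a `U`-dependent remainder kernel family `R U` with `|⟨ψ, R_U ψ⟩| ≤ C` on channel states for
  `0 < U ≤ U₁` gives `KLChannelRemainderBound tp a b (klLambdaR tp R) (M + C·U₁) U₁` for
  `klLambdaR = inf (pairingForm + U³⟨·,K₃·⟩ + U⁴⟨·,R_U·⟩)` — the «any remainder constant `C`» statement of the lane's
  `…KlAllOrdersSelectionAnyC4` in the slot's currency.

Honest framing: `klLambda3` is the THIRD-ORDER TRUNCATION of the pp-irreducible vertex (RKS App. A (3a)–(3f)), not the
renormalised effective interaction of an FKT-scale analysis; `M` (and `C`, `R`) are hypotheses — the lane's certified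
third-order tables (U0-TABLE v4, Hilbert–Schmidt norms of entrywise majorants in two interval implementations) are where a
literal `M` would come from, and no literal is typed here.  Register expectation 0.00.  RECORD ≠ DECIDED; nothing about K₃
convergence of the Bochner integrals, the window beyond the records, or superconductivity; a Kohn–Luttinger `O(U²)`/`O(U³)` channel
statement is not ODLRO and nothing here proves superconductivity in the Hubbard model.  Filed `--supports stmt-HubbardSuperconductivity-0158`.

References: S. Raghu, S. A. Kivelson, D. J. Scalapino, Phys. Rev. B 81 (2010) 224505, §II (7), (12)–(13), §IV–V (25), App. A;
W. Kohn, J. M. Luttinger, Phys. Rev. Lett. 15 (1965) 524.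
-/

noncomputable section

-- the tree's namespace `Summit.<Summit>.<Problem>.Theorems` repeats the summit name by design (D-0017)
set_option linter.dupNamespace false

namespace Summit.HubbardSuperconductivity.HubbardSuperconductivity.Theorems

open MeasureTheory Literature.MathematicalPhysics.QuantumLattice CwKLChiralWindow KlThirdOrder
open scoped Pointwise

/-! ### §1 The inf-perturbation lemma (all junk cases of `Real.sInf` included) -/

/-- **Bounded perturbations move a real infimum by at most their bound — nonempty, bounded-below case.**
For `S ≠ ∅`, `f '' S` bounded below and `|g| ≤ M` on `S`: `sInf (f '' S) − M ≤ sInf ((f+g) '' S) ≤ sInf (f '' S) + M`. [folklore] -/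
theorem kl_sInf_image_add_mem_of_bddBelow {α : Type*} {S : Set α} {f g : α → ℝ} {M : ℝ} (hS : S.Nonempty)
    (hb : BddBelow (f '' S)) (hg : ∀ x ∈ S, |g x| ≤ M) :
    sInf (f '' S) - M ≤ sInf ((fun x => f x + g x) '' S) ∧ sInf ((fun x => f x + g x) '' S) ≤ sInf (f '' S) + M := by
  have hb' : BddBelow ((fun x => f x + g x) '' S) := by
    obtain ⟨L, hL⟩ := hb
    refine ⟨L - M, ?_⟩
    rintro _ ⟨x, hx, rfl⟩
    have h1 : L ≤ f x := hL ⟨x, hx, rfl⟩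
    have h2 := (abs_le.1 (hg x hx)).1
    linarith
  refine ⟨?_, ?_⟩
  · refine le_csInf (hS.image _) ?_
    rintro _ ⟨x, hx, rfl⟩
    have h1 : sInf (f '' S) ≤ f x := csInf_le hb ⟨x, hx, rfl⟩
    have h2 := (abs_le.1 (hg x hx)).1
    linarith
  · refine le_of_forall_pos_lt_add fun e he => ?_
    obtain ⟨_, ⟨x, hx, rfl⟩, hfx⟩ := exists_lt_of_csInf_lt (hS.image f) (lt_add_of_pos_right (sInf (f '' S)) he)
    have h1 : sInf ((fun x => f x + g x) '' S) ≤ f x + g x := csInf_le hb' ⟨x, hx, rfl⟩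
    have h2 := (abs_le.1 (hg x hx)).2
    linarith

/-- **The inf-perturbation lemma** (total version, `Real.sInf` junk values included): if `|g| ≤ M` on `S` and `0 ≤ M` then
`|sInf ((f+g) '' S) − sInf (f '' S)| ≤ M`.  (Empty `S`: both sides are `sInf ∅ = 0`; `f '' S` unbounded below: so is
`(f+g) '' S`, both are `0`; otherwise the previous lemma.) [folklore] -/
theorem kl_abs_sInf_image_add_sub_le {α : Type*} {S : Set α} {f g : α → ℝ} {M : ℝ}
    (hg : ∀ x ∈ S, |g x| ≤ M) (hM : 0 ≤ M) :
    |sInf ((fun x => f x + g x) '' S) - sInf (f '' S)| ≤ M := by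
  rcases S.eq_empty_or_nonempty with hS | hS
  · subst hS
    simp only [Set.image_empty, Real.sInf_empty, sub_self, abs_zero]
    exact hM
  by_cases hb : BddBelow (f '' S)
  · have h := kl_sInf_image_add_mem_of_bddBelow hS hb hg
    exact abs_le.2 ⟨by linarith [h.1], by linarith [h.2]⟩
  · have hb' : ¬ BddBelow ((fun x => f x + g x) '' S) := by
      rintro ⟨L, hL⟩
      refine hb ⟨L - M, ?_⟩
      rintro _ ⟨x, hx, rfl⟩
      have h1 : L ≤ f x + g x := hL ⟨x, hx, rfl⟩
      have h2 := (abs_le.1 (hg x hx)).2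
      linarith
    rw [Real.sInf_of_not_bddBelow hb, Real.sInf_of_not_bddBelow hb', sub_self, abs_zero]
    exact hM

/-! ### §2 The objects: third-order channel bottom in pairing units, and the two-sided third-order enclosure kind -/

/-- **Third-order channel bottom in pairing units** for the `t`–`t′` band: `Λ₃(χ; μ, U) = inf_ψ (⟨ψ, Γ^{(2)}_U ψ⟩ + U³ ⟨ψ, K₃ ψ⟩)`
over the normalised gap functions of the channel `χ` on the Fermi curve of `ε_{t′}` at level `μ` (`Γ^{(2)}_U = U + U² χ₀(k+k')` the
Kohn–Luttinger kernel, `pairingForm`; `K₃ = klThirdOrderKernel`, the `U³` coefficient of the pp-irreducible vertex; `sInf` in `ℝ`).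
At `t′ = 0` this is `U² · channelInf3 ε₀ μ U χ` (`klLambda3_zero_eq`). [cite: RaghuKivelsonScalapino2010, §V (25), App. A] -/
def klLambda3 (tp : ℝ) (χ : D4Irrep) (μ U : ℝ) : ℝ :=
  sInf ((fun ψ => pairingForm (squareDispersion 1 tp) μ U ψ +
      U ^ 3 * kform (fermiCurveMeasure (squareDispersion 1 tp) μ) (klThirdOrderKernel (squareDispersion 1 tp) μ) ψ) ''
    {ψ | IsChannelState (squareDispersion 1 tp) μ χ ψ})

/-- **Two-sided third-order enclosure — HYPOTHESIS KIND** (a slot; asserts nothing): on the window `μ ∈ [a, b]` of the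
`t`–`t′` band, the third-order kernel form is bounded by `M` in absolute value on every normalised gap function of every
channel: `|⟨ψ, K₃ ψ⟩_{σ_μ}| ≤ M`.  (A Hilbert–Schmidt bound of an entrywise majorant of the parity-reduced kernel delivers it; the
lane's U0-TABLE allowances `h3`, `t_B` are such norms.) [folklore] -/
def KlThirdOrder.FormBound (tp a b M : ℝ) : Prop :=
  ∀ μ ∈ Set.Icc a b, ∀ (χ : D4Irrep) (ψ : Momentum → ℝ), IsChannelState (squareDispersion 1 tp) μ χ ψ →
    |kform (fermiCurveMeasure (squareDispersion 1 tp) μ) (klThirdOrderKernel (squareDispersion 1 tp) μ) ψ| ≤ M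

/-! ### §3 The slot's remainder hypothesis holds for `Λ₃` -/

/-- **`KLChannelRemainderBound` for the third-order bottoms.** A two-sided third-order enclosure `FormBound tp a b M` with
`0 ≤ M` gives `|Λ₃(χ; μ, U) − channelInf ε_{t′} μ U χ| ≤ M·U³` for every `μ ∈ [a, b]`, every `U > 0` (so every `U₁`) and every
channel — the inf-perturbation lemma with `g = U³⟨·, K₃ ·⟩`. [cite: RaghuKivelsonScalapino2010, §IV] -/
theorem klChannelRemainderBound_lambda3 {tp a b M : ℝ} (hM : 0 ≤ M) (hF : KlThirdOrder.FormBound tp a b M) (U₁ : ℝ) :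
    KLChannelRemainderBound tp a b (klLambda3 tp) M U₁ := by
  intro μ hμ U hU χ
  have hU3 : 0 ≤ U ^ 3 := pow_nonneg hU.1.le 3
  have key := kl_abs_sInf_image_add_sub_le
    (S := {ψ | IsChannelState (squareDispersion 1 tp) μ χ ψ})
    (f := pairingForm (squareDispersion 1 tp) μ U)
    (g := fun ψ => U ^ 3 * kform (fermiCurveMeasure (squareDispersion 1 tp) μ)
      (klThirdOrderKernel (squareDispersion 1 tp) μ) ψ)
    (M := M * U ^ 3) (fun ψ hψ => by
      rw [abs_mul, abs_of_nonneg hU3, mul_comm]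
      exact mul_le_mul_of_nonneg_right (hF μ hμ χ ψ hψ) hU3) (mul_nonneg hM hU3)
  simpa [klLambda3, channelInf] using key

/-! ### §4 Identification with the tree's `channelInf3` at `t′ = 0` -/

/-- For `ε₀ = squareDispersion 1 0`, `μ ∈ (−4, 0)`, `U ≠ 0` and `ψ ∈ L²(σ_μ)`:
`pairingForm ε₀ μ U ψ + U³⟨ψ, K₃ ψ⟩ = U² · thirdOrderForm ε₀ μ U ψ` (the Hilbert–Schmidt frame splits the pairing form into
`U(∫ψ)² + U²⟨ψ, χ₀ ψ⟩`). [folklore] -/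
theorem kl_pairingForm_add_cube_eq_sq_mul_thirdOrderForm {μ : ℝ} (hμ : μ ∈ Set.Ioo (-4 : ℝ) 0) {U : ℝ} (hU : U ≠ 0)
    {ψ : Momentum → ℝ} (hψ : MemLp ψ 2 (fermiCurveMeasure (squareDispersion 1 0) μ)) :
    pairingForm (squareDispersion 1 0) μ U ψ +
        U ^ 3 * kform (fermiCurveMeasure (squareDispersion 1 0) μ) (klThirdOrderKernel (squareDispersion 1 0) μ) ψ =
      U ^ 2 * thirdOrderForm (squareDispersion 1 0) μ U ψ := by
  rw [(stub_klFrameHS stub_klKernelHS μ hμ U ψ hψ).1]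
  unfold thirdOrderForm kform lindhardKernel
  field_simp

/-- **`Λ₃ = U² · channelInf3` at `t′ = 0`**: for `μ ∈ (−4, 0)` and `0 < U`, `klLambda3 0 χ μ U = U² · channelInf3 ε₀ μ U χ`.
[cite: RaghuKivelsonScalapino2010, §V (25)] -/
theorem klLambda3_zero_eq {μ : ℝ} (hμ : μ ∈ Set.Ioo (-4 : ℝ) 0) {U : ℝ} (hU : 0 < U) (χ : D4Irrep) :
    klLambda3 0 χ μ U = U ^ 2 * channelInf3 (squareDispersion 1 0) μ U χ := by
  unfold klLambda3 channelInf3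
  have himg : (fun ψ => pairingForm (squareDispersion 1 0) μ U ψ +
        U ^ 3 * kform (fermiCurveMeasure (squareDispersion 1 0) μ) (klThirdOrderKernel (squareDispersion 1 0) μ) ψ) ''
        {ψ | IsChannelState (squareDispersion 1 0) μ χ ψ} =
      (U ^ 2) • ((thirdOrderForm (squareDispersion 1 0) μ U) '' {ψ | IsChannelState (squareDispersion 1 0) μ χ ψ}) := by
    rw [← Set.image_smul, Set.image_image]
    refine Set.image_congr fun ψ hψ => ?_
    rw [smul_eq_mul]
    exact kl_pairingForm_add_cube_eq_sq_mul_thirdOrderForm hμ hU.ne' hψ.1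
  rw [himg, Real.sInf_smul_of_nonneg (sq_nonneg U), smul_eq_mul]

/-! ### §5 Selection through third order below the explicit `U₀` -/

/-- **Third-order `B1g` selection from a second-order margin (generic, `t′ = 0`).** If `KLB1gDominatesTP 0 a b γ` with
`(a, b) ⊆ (−4, 0)`, `0 < γ`, and the two-sided third-order enclosure `FormBound 0 a b M` holds with `0 ≤ M`, then for every
`μ ∈ [a, b]`, every `0 < U < klU0 γ M 1 = min(1, γ/2M)` and every `χ ≠ B1g`:
`channelInf3 ε₀ μ U B1g < channelInf3 ε₀ μ U χ`. [cite: RaghuKivelsonScalapino2010, §II (13), §IV] -/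
theorem klChannelInf3_B1g_lt_of_dominates {a b γ M : ℝ} (hD : KLB1gDominatesTP 0 a b γ) (ha : -4 < a) (hb : b < 0)
    (hγ : 0 < γ) (hM : 0 ≤ M) (hF : KlThirdOrder.FormBound 0 a b M)
    {μ : ℝ} (hμ : μ ∈ Set.Icc a b) {U : ℝ} (hU0 : 0 < U) (hU : U < klU0 γ M 1) {χ : D4Irrep} (hχ : χ ≠ D4Irrep.B1g) :
    channelInf3 (squareDispersion 1 0) μ U D4Irrep.B1g < channelInf3 (squareDispersion 1 0) μ U χ := by
  have hμ' : μ ∈ Set.Ioo (-4 : ℝ) 0 := ⟨lt_of_lt_of_le ha hμ.1, lt_of_le_of_lt hμ.2 hb⟩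
  have h := klB1g_full_lt_of_lt_klU0 hD (klChannelRemainderBound_lambda3 hM hF 1) hM hγ hμ hU0 hU hχ
  rw [klLambda3_zero_eq hμ' hU0, klLambda3_zero_eq hμ' hU0] at h
  exact lt_of_mul_lt_mul_left h (sq_nonneg U)

/-- **Third-order `B1g` selection from an accepted `t′ = 0` record** `c` (checker `checkB1gD`, modulo its certified enclosures
`hE`), given the two-sided third-order enclosure on its window with `0 ≤ M`: for `μ ∈ [c.mub, c.mua]`,
`0 < U < klU0 c.gamma M 1` and `χ ≠ B1g`, `channelInf3 ε₀ μ U B1g < channelInf3 ε₀ μ U χ`.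
[cite: RaghuKivelsonScalapino2010, §III Fig. 2, §IV] -/
theorem klChannelInf3_B1g_lt_of_checkB1gD (c : KLCert) (hc : c.checkB1gD = true) (hE : c.EnclosuresB1g)
    {M : ℝ} (hM : 0 ≤ M) (hF : KlThirdOrder.FormBound 0 ((c.mub : ℚ) : ℝ) ((c.mua : ℚ) : ℝ) M)
    {μ : ℝ} (hμ : μ ∈ Set.Icc ((c.mub : ℚ) : ℝ) ((c.mua : ℚ) : ℝ)) {U : ℝ} (hU0 : 0 < U)
    (hU : U < klU0 ((c.gamma : ℚ) : ℝ) M 1) {χ : D4Irrep} (hχ : χ ≠ D4Irrep.B1g) :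
    channelInf3 (squareDispersion 1 0) μ U D4Irrep.B1g < channelInf3 (squareDispersion 1 0) μ U χ := by
  obtain ⟨⟨h4, -, h0, hγ⟩, -, -⟩ := klb1gd_coverLogic c hc
  exact klChannelInf3_B1g_lt_of_dominates (klb1gd_window_U c hc hE) (by exact_mod_cast h4) (by exact_mod_cast h0)
    (by exact_mod_cast hγ) hM hF hμ hU0 hU hχ

/-- The doping-window margin of record as a real number: `min(γ_A, γ_B, γ_C) = 437/16384` (`= γ_B`; kernel decision on the three
record rationals). [folklore] -/
theorem klb1g_window_d010_d020_gamma_eq :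
    min (min ((klCertB1gWinA.gamma : ℚ) : ℝ) ((klCertB1gWinB.gamma : ℚ) : ℝ)) ((klCertB1gWinC.gamma : ℚ) : ℝ) = 437 / 16384 := by
  have h : min (min klCertB1gWinA.gamma klCertB1gWinB.gamma) klCertB1gWinC.gamma = 437 / 16384 := by decide +kernel
  have h' := congrArg (fun q : ℚ => (q : ℝ)) h
  push_cast at h'
  exact h'

/-- **Third-order `B1g` selection on the doping window `δ ∈ [0.10, 0.20]`** (`μ ∈ [−0.42749, −0.1775]`, the three window records
`klCertB1gWin{A,B,C}` modulo their certified enclosures, margin `γ = 437/16384 ≈ 0.02667`), given the two-sided third-order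
enclosure `FormBound 0 (−0.42749) (−0.1775) M` with `0 ≤ M`: for every such `μ`, every `0 < U < klU0 (437/16384) M 1 = min(1, 437/(32768·M))`
and every `χ ≠ B1g`, **`channelInf3 ε₀ μ U B1g < channelInf3 ε₀ μ U χ`** — the `d_{x²−y²}` channel has the strictly lowest bottom of
the pp-irreducible vertex through third order. [cite: RaghuKivelsonScalapino2010, §III Fig. 2, §IV–V] -/
theorem klChannelInf3_B1g_lt_window_d010_d020 (hA : klCertB1gWinA.EnclosuresB1g) (hB : klCertB1gWinB.EnclosuresB1g)
    (hC : klCertB1gWinC.EnclosuresB1g) {M : ℝ} (hM : 0 ≤ M) (hF : KlThirdOrder.FormBound 0 (-0.42749) (-0.1775) M)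
    {μ : ℝ} (hμ : μ ∈ Set.Icc (-0.42749 : ℝ) (-0.1775)) {U : ℝ} (hU0 : 0 < U) (hU : U < klU0 (437 / 16384) M 1)
    {χ : D4Irrep} (hχ : χ ≠ D4Irrep.B1g) :
    channelInf3 (squareDispersion 1 0) μ U D4Irrep.B1g < channelInf3 (squareDispersion 1 0) μ U χ := by
  have hD : KLB1gDominatesTP 0 (-0.42749) (-0.1775)
      (min (min ((klCertB1gWinA.gamma : ℚ) : ℝ) ((klCertB1gWinB.gamma : ℚ) : ℝ)) ((klCertB1gWinC.gamma : ℚ) : ℝ)) :=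
    klb1g_window_d010_d020 hA hB hC
  rw [klb1g_window_d010_d020_gamma_eq] at hD
  exact klChannelInf3_B1g_lt_of_dominates hD (by norm_num) (by norm_num) (by norm_num) hM hF hμ hU0 hU hχ

/-- The explicit threshold of the doping window is positive for every `M`: `0 < klU0 (437/16384) M 1`. [folklore] -/
theorem klU0_window_d010_d020_pos (M : ℝ) : 0 < klU0 (437 / 16384) M 1 :=
  klU0_pos (by norm_num) one_pos

/-- **Record `klCertB1gWinA`** (`μ ∈ [−0.42749, −0.3775]`, `δ ≈ 0.17–0.20`, `γ_A = 30209/2²⁰`): third-order `B1g` selection for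
`0 < U < klU0 γ_A M 1`, modulo `EnclosuresB1g` and `FormBound 0 mub mua M`. [cite: RaghuKivelsonScalapino2010, §III Fig. 2, §IV] -/
theorem klChannelInf3_B1g_lt_WinA (hE : klCertB1gWinA.EnclosuresB1g) {M : ℝ} (hM : 0 ≤ M)
    (hF : KlThirdOrder.FormBound 0 ((klCertB1gWinA.mub : ℚ) : ℝ) ((klCertB1gWinA.mua : ℚ) : ℝ) M)
    {μ : ℝ} (hμ : μ ∈ Set.Icc ((klCertB1gWinA.mub : ℚ) : ℝ) ((klCertB1gWinA.mua : ℚ) : ℝ)) {U : ℝ} (hU0 : 0 < U)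
    (hU : U < klU0 ((klCertB1gWinA.gamma : ℚ) : ℝ) M 1) {χ : D4Irrep} (hχ : χ ≠ D4Irrep.B1g) :
    channelInf3 (squareDispersion 1 0) μ U D4Irrep.B1g < channelInf3 (squareDispersion 1 0) μ U χ :=
  klChannelInf3_B1g_lt_of_checkB1gD klCertB1gWinA klCertB1gWinA_check hE hM hF hμ hU0 hU hχ

/-- **Record `klCertB1gWinB`** (`μ ∈ [−0.3775, −0.2275]`, `γ_B = 437/16384`): third-order `B1g` selection for `0 < U < klU0 γ_B M 1`,
modulo `EnclosuresB1g` and `FormBound 0 mub mua M`. [cite: RaghuKivelsonScalapino2010, §III Fig. 2, §IV] -/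
theorem klChannelInf3_B1g_lt_WinB (hE : klCertB1gWinB.EnclosuresB1g) {M : ℝ} (hM : 0 ≤ M)
    (hF : KlThirdOrder.FormBound 0 ((klCertB1gWinB.mub : ℚ) : ℝ) ((klCertB1gWinB.mua : ℚ) : ℝ) M)
    {μ : ℝ} (hμ : μ ∈ Set.Icc ((klCertB1gWinB.mub : ℚ) : ℝ) ((klCertB1gWinB.mua : ℚ) : ℝ)) {U : ℝ} (hU0 : 0 < U)
    (hU : U < klU0 ((klCertB1gWinB.gamma : ℚ) : ℝ) M 1) {χ : D4Irrep} (hχ : χ ≠ D4Irrep.B1g) :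
    channelInf3 (squareDispersion 1 0) μ U D4Irrep.B1g < channelInf3 (squareDispersion 1 0) μ U χ :=
  klChannelInf3_B1g_lt_of_checkB1gD klCertB1gWinB klCertB1gWinB_check hE hM hF hμ hU0 hU hχ

/-- **Record `klCertB1gWinC`** (`μ ∈ [−0.2275, −0.1775]`, `δ ≈ 0.10–0.12`, `γ_C = 32921/2²⁰`): third-order `B1g` selection for
`0 < U < klU0 γ_C M 1`, modulo `EnclosuresB1g` and `FormBound 0 mub mua M`. [cite: RaghuKivelsonScalapino2010, §III Fig. 2, §IV] -/
theorem klChannelInf3_B1g_lt_WinC (hE : klCertB1gWinC.EnclosuresB1g) {M : ℝ} (hM : 0 ≤ M)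
    (hF : KlThirdOrder.FormBound 0 ((klCertB1gWinC.mub : ℚ) : ℝ) ((klCertB1gWinC.mua : ℚ) : ℝ) M)
    {μ : ℝ} (hμ : μ ∈ Set.Icc ((klCertB1gWinC.mub : ℚ) : ℝ) ((klCertB1gWinC.mua : ℚ) : ℝ)) {U : ℝ} (hU0 : 0 < U)
    (hU : U < klU0 ((klCertB1gWinC.gamma : ℚ) : ℝ) M 1) {χ : D4Irrep} (hχ : χ ≠ D4Irrep.B1g) :
    channelInf3 (squareDispersion 1 0) μ U D4Irrep.B1g < channelInf3 (squareDispersion 1 0) μ U χ :=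
  klChannelInf3_B1g_lt_of_checkB1gD klCertB1gWinC klCertB1gWinC_check hE hM hF hμ hU0 hU hχ

/-! ### §6 The all-orders twin: any remainder kernel family with a form bound `C` -/

/-- **All-orders channel bottom in pairing units** for a remainder kernel family `R` (read `R_U(k,k') = (Γ_U − U − U²χ₀ − U³K₃)(k,k')/U⁴`,
the pp-irreducible vertex beyond third order at the coupling at hand):
`Λ_R(χ; μ, U) = inf_ψ (⟨ψ, Γ^{(2)}_U ψ⟩ + U³⟨ψ, K₃ ψ⟩ + U⁴⟨ψ, R_U ψ⟩)` over the normalised channel states.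
[cite: RaghuKivelsonScalapino2010, §IV] -/
def klLambdaR (tp : ℝ) (R : ℝ → Momentum → Momentum → ℝ) (χ : D4Irrep) (μ U : ℝ) : ℝ :=
  sInf ((fun ψ => pairingForm (squareDispersion 1 tp) μ U ψ +
      (U ^ 3 * kform (fermiCurveMeasure (squareDispersion 1 tp) μ) (klThirdOrderKernel (squareDispersion 1 tp) μ) ψ +
        U ^ 4 * kform (fermiCurveMeasure (squareDispersion 1 tp) μ) (R U) ψ)) ''
    {ψ | IsChannelState (squareDispersion 1 tp) μ χ ψ})

/-- **Remainder form bound — HYPOTHESIS KIND** (a slot; asserts nothing): for `μ ∈ [a, b]`, `0 < U ≤ U₁` and every normalised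
channel state `ψ`, `|⟨ψ, R_U ψ⟩_{σ_μ}| ≤ C`. [folklore] -/
def KlThirdOrder.RemainderFormBound (tp a b : ℝ) (R : ℝ → Momentum → Momentum → ℝ) (C U₁ : ℝ) : Prop :=
  ∀ μ ∈ Set.Icc a b, ∀ U ∈ Set.Ioc (0 : ℝ) U₁, ∀ (χ : D4Irrep) (ψ : Momentum → ℝ),
    IsChannelState (squareDispersion 1 tp) μ χ ψ →
      |kform (fermiCurveMeasure (squareDispersion 1 tp) μ) (R U) ψ| ≤ C

/-- **`KLChannelRemainderBound` to all orders for any remainder constant.** `FormBound tp a b M` (`0 ≤ M`) and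
`RemainderFormBound tp a b R C U₁` (`0 ≤ C`) give `|Λ_R(χ; μ, U) − channelInf ε_{t′} μ U χ| ≤ (M + C·U₁)·U³` for `μ ∈ [a, b]`,
`0 < U ≤ U₁` — hence strict `B1g` selection below `klU0 γ (M + C·U₁) U₁` by `klB1g_full_lt_of_lt_klU0`.
[cite: RaghuKivelsonScalapino2010, §IV] -/
theorem klChannelRemainderBound_lambdaR {tp a b M C U₁ : ℝ} {R : ℝ → Momentum → Momentum → ℝ} (hM : 0 ≤ M) (hC : 0 ≤ C)
    (hF : KlThirdOrder.FormBound tp a b M) (hR : KlThirdOrder.RemainderFormBound tp a b R C U₁) :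
    KLChannelRemainderBound tp a b (klLambdaR tp R) (M + C * U₁) U₁ := by
  intro μ hμ U hU χ
  have hU0 : 0 ≤ U := hU.1.le
  have hU3 : 0 ≤ U ^ 3 := pow_nonneg hU0 3
  have hU4 : U ^ 4 ≤ U₁ * U ^ 3 := by nlinarith [hU.2, hU3]
  have key := kl_abs_sInf_image_add_sub_le
    (S := {ψ | IsChannelState (squareDispersion 1 tp) μ χ ψ})
    (f := pairingForm (squareDispersion 1 tp) μ U)
    (g := fun ψ => U ^ 3 * kform (fermiCurveMeasure (squareDispersion 1 tp) μ)
        (klThirdOrderKernel (squareDispersion 1 tp) μ) ψ +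
      U ^ 4 * kform (fermiCurveMeasure (squareDispersion 1 tp) μ) (R U) ψ)
    (M := (M + C * U₁) * U ^ 3) (fun ψ hψ => by
      have h3 := hF μ hμ χ ψ hψ
      have h4 := hR μ hμ U hU χ ψ hψ
      have e3 : |U ^ 3 * kform (fermiCurveMeasure (squareDispersion 1 tp) μ)
          (klThirdOrderKernel (squareDispersion 1 tp) μ) ψ| ≤ U ^ 3 * M := by
        rw [abs_mul, abs_of_nonneg hU3]; exact mul_le_mul_of_nonneg_left h3 hU3
      have e4 : |U ^ 4 * kform (fermiCurveMeasure (squareDispersion 1 tp) μ) (R U) ψ| ≤ U ^ 4 * C := by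
        rw [abs_mul, abs_of_nonneg (pow_nonneg hU0 4)]; exact mul_le_mul_of_nonneg_left h4 (pow_nonneg hU0 4)
      have e5 : U ^ 4 * C ≤ U₁ * U ^ 3 * C := mul_le_mul_of_nonneg_right hU4 hC
      calc _ ≤ U ^ 3 * M + U ^ 4 * C := (abs_add_le _ _).trans (add_le_add e3 e4)
        _ ≤ (M + C * U₁) * U ^ 3 := by nlinarith)
    (mul_nonneg (add_nonneg hM (mul_nonneg hC (le_trans hU0 hU.2))) hU3)
  simpa [klLambdaR, channelInf] using key

end Summit.HubbardSuperconductivity.HubbardSuperconductivity.Theorems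

end
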